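/-
Copyright (c) 2026 the pub-hodgecm-mathlib formalisation cell (harness21).  Prover seat hodgecm-mathlib-F0P3a-p06 (g20), line LH3 letter L3′, W-road brick (W2) «invariant smooth germ = class
function», file (W2c) (census binder LH3-p01 (g6), RULING #26; co-hand A-p12 (g28) for (W2a)); 2026-09-02.
-/
import Literature.NumberTheory.Rogawski1990.ArchBouazizClassMap         -- ★ p851469 (LH10-p01 (g5)): `bzClassMap`, `bzClassMap_of_mem ∕ _of_not_mem`; brings `flipAt ∕ negXAt ∕ nrm`, `circleExp_ne_iff_forall_int`
import Literature.Analysis.Calculus.EvenJetMatching                    -- ★ p851502 (A-p12 (g28)): `exists_contDiff_cos_eq_comp_sq` (`cos ν = g(ν²)`, `cosh x = g(−x²)`)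
import Mathlib
import Literature.Analysis.Calculus.ParityNormalForm                   -- ★ (A-p12 (g28), (W2a)): `exists_contDiff_parity_normalForm`
import HarnessLib

/-!
# (W2c) Invariant smooth germs at a wall point are CLASS FUNCTIONS times the compact sine factor — the `hW2` organ of the filtration road for Bouaziz's surjectivity on `H_∞`
# (Bouaziz 1994 §4 pp. 585–586, §5.1 p. 588; Shelstad 1979 §4)

Topic `NumberTheory/Rogawski1990`; namespace `Literature.NumberTheory.Rogawski1990`.  THEOREMS ONLY (no `def`, no instance, no notation, no axiom, no named fact, no `sorry`);
kernel lane `--kind proof --supports stmt-HodgeConjecture-24833`.  Cell `pub/hodgecm-mathlib`, crux H413 = `stmt-HodgeConjecture-24833`; line LH3 (closer stub `stub_N9`), letter L3′,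
organ O-L3′-S-WALL (local surjectivity of `fH ↦ stOrbFamH νH fH` at a WALL base class), FILTRATION ROAD (LH3-p01 (g6) W-ROAD CENSUS v1, RULING #26): ★ `bzLocalSurjWall_of_parts`
((W4)) ← ★ `wallGerm_classMultiple_of_parts` ((W12-asm), p851576) ← **its hypothesis `hW2` = THIS FILE's head `exists_contDiff_classFunction_of_parity`, TOKEN FOR TOKEN**.

THE MATHEMATICS.  Fix a chart `S`, the central compact places `P` (off `S`), the central split places `T ⊆ S`, and a fibre point `c₀` ON the walls (`c₀ w 0 = c₀ w 2` on `P`,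
`c₀ w 0 = 0` on `T`, regular elsewhere).  A germ `G` smooth on `ball c₀ δ`, ODD under the compact-wall flips `flipAt w` (`w ∈ P`) and EVEN under the split-wall sign changes `negXAt w`
(`w ∈ T`) — the parities of `eρ_S · D_S` for `D ∈ I^st_c` — is, on a smaller ball whose radius `δ′` is FIXED BEFORE `G`, of the form `(∏_{w ∉ S} 2i sin((c w 0 − c w 2)/2)) · U(bzClassMap S c)`
with `U` a GLOBAL smooth function on the class space `W → ℂ × ℂ × ℂ`.  Road: (§6) an invariant product bump makes `G` global with global parities; the flips are the reflections
`y ↦ y − 2ℓ_w(y) • v_w` (`ℓ_w = ψ_w = (y w 0 − y w 2)/2`, `v_w = nrm w` on `P`; `ℓ_w = y w 0`, `v_w = e_{(w,0)}` on `T`, §7), so the PARITY NORMAL FORM ★ `exists_contDiff_parity_normalForm`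
((W2a), A-p12 (g28): Hadamard ∘ Whitney-even ∘ Whitney extension) gives `G = (∏_{w∈P} ψ_w) · H ∘ sq` with `H` global smooth and `sq` = «wall coordinates squared»; (§1) from
`cos ν = g(ν²)` (★ `EvenJetMatching`): `g(0) = 1`, `sin ν = −2ν g′(ν²)`, `g′(0) = −1/2`, `sinh x = −2x g′(−x²)`, so `∏_{w ∉ S} 2i sin ψ_w = (∏_P ψ_w) · D̃ ∘ sq` with `D̃` smooth,
`D̃(sq c₀) ≠ 0`; (§5) the class map FACTORS through the squares, `bzClassMap S = Φ ∘ sq` with `Φ` smooth and — the heart — `DΦ(sq c₀)` INJECTIVE (block by block along lines: the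
`u`-entry kills `k 1`, the `det`-entry the phase, the `tr`-entry the rest, using `g′(0) ≠ 0` at central places, `sin ψ₀ ≠ 0` ∕ `sinh x₀ ≠ 0` at regular ones, §3–§4); (§8) ★ (W2b)
`exists_nhds_forall_contDiff_comp_eq_of_injective_fderiv` pushes `H · (D̃⁻¹ globalised)` forward along `Φ` to a global `U` on a neighbourhood fixed by `Φ` alone — so `δ′` precedes `G`.

* §1 profile facts `profile_zero`, `sin_eq_neg_two_mul_mul_deriv`, `deriv_profile_zero`, `sinh_eq_neg_two_mul_mul_deriv`, `exp_add_exp_neg_eq`; §2 `coe_circleExp_add_coe_circleExp(_aux)`,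
  `coe_circleExp_mul_coe_circleExp`; §3 line derivatives; §4 `eq_zero_of_hasDerivAt_{compactCentral,compactRegular,splitCentral,splitRegular}Block`; §5 `contDiff_squaredClassModel`,
  `injective_fderiv_squaredClassModel`, `squaredClassModel_sq_eq_bzClassMap`; §6 `exists_invariant_bump`; §7 `flipAt_eq_sub_smul_nrm`, `negXAt_eq_sub_smul_single`, `sq_apply`;
  §8 **`exists_contDiff_classFunction_of_parity`**.
HONEST LABEL: HC_CM is proved only modulo the 7 printed citations (2 remaining: hLiu418 = `stmt-HodgeConjecture-24832`, h413 = `stmt-HodgeConjecture-24833`) until rung 0 closes;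
(W2) pays the `hW2` socket only — O-L3′-S-WALL closes when (W3-asm) and the payer land too; count-neutral.

## References
* [Bouaziz1994IntegralesOrbitales] A. Bouaziz, *Intégrales orbitales sur les groupes de Lie réductifs*, Ann. Sci. ÉNS (4) 27 (1994) 573–609, §3.2 p. 580, §4 pp. 585–586, §5.1 p. 588.
* [Shelstad1979] D. Shelstad, *Characters and inner forms of a quasi-split group over ℝ*, Compositio Math. 39 (1979) 11–45, §4 Lemma 4.3 p. 25.
* [Lee2012] J. M. Lee, *Introduction to Smooth Manifolds*, 2nd ed., GTM 218 (2012), Thm. 4.12, Lemma 2.26.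
-/

set_option autoImplicit false

noncomputable section

open Set Function Metric Filter Complex
open Literature.NumberTheory.Automorphic.ArchCartan
open scoped Topology ContDiff


namespace Literature.NumberTheory.Rogawski1990

/-! ## §0 (W2b) PRIVATE COPIES — ★ p851563 `Literature/Analysis/Calculus/ImmersionLeftInverse.lean` is in the tree but its olean is not served on the farm at filing time;
these three `private` copies (primed names, identical proofs) go away in ED. 2 in favour of the import. -/

section ImmersionPrivate

variable {E F : Type*} [NormedAddCommGroup E] [NormedSpace ℝ E] [FiniteDimensional ℝ E] [NormedAddCommGroup F] [NormedSpace ℝ F]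

/-- **A `C^n` map on an open set agrees near any of its points with a GLOBAL `C^n` map** (multiply by a smooth bump `= 1` near the point and supported in the open set).
[cite: Lee2012, Lemma 2.26] [cite: HormanderALPDO1, Thm. 1.4.1] -/
private theorem exists_contDiff_eventuallyEq_of_contDiffOn' {n : ℕ∞} {f : E → F} {U : Set E} (hU : IsOpen U) {x : E} (hx : x ∈ U) (hf : ContDiffOn ℝ n f U) :
    ∃ g : E → F, ContDiff ℝ n g ∧ g =ᶠ[𝓝 x] f := by
  obtain ⟨r, hr, hrU⟩ : ∃ r > 0, closedBall x (2 * r) ⊆ U := by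
    obtain ⟨r, hr, hrU⟩ := Metric.isOpen_iff.1 hU x hx
    refine ⟨r / 4, by positivity, (closedBall_subset_ball (by linarith)).trans hrU⟩
  let χ : ContDiffBump x := ⟨r, 2 * r, hr, by linarith⟩
  refine ⟨fun y => χ y • f y, ?_, ?_⟩
  · rw [contDiff_iff_contDiffAt]
    intro y
    by_cases hy : y ∈ U
    · exact χ.contDiff.contDiffAt.smul (hf.contDiffAt (hU.mem_nhds hy))
    · -- off `U` the product vanishes near `y` (`tsupport χ = closedBall x (2r) ⊆ U`)
      have hy' : y ∉ tsupport (χ : E → ℝ) := fun h => hy (hrU (by simpa [χ.tsupport_eq] using h))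
      have h0 : (fun y => χ y • f y) =ᶠ[𝓝 y] fun _ => 0 := by
        have : (χ : E → ℝ) =ᶠ[𝓝 y] 0 := by
          rw [← notMem_tsupport_iff_eventuallyEq] at *
          exact hy'
        filter_upwards [this] with z hz
        simp only [hz, Pi.zero_apply, zero_smul]
      exact (contDiffAt_const (c := (0 : F))).congr_of_eventuallyEq h0
  · have h1 : ∀ᶠ y in 𝓝 x, χ y = 1 := by
      filter_upwards [closedBall_mem_nhds x hr] with y hy
      exact χ.one_of_mem_closedBall hy
    filter_upwards [h1] with y hy
    simp only [hy, one_smul]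


end ImmersionPrivate

section ImmersionPrivate2

variable {X Y : Type*} [NormedAddCommGroup X] [NormedSpace ℝ X] [FiniteDimensional ℝ X] [NormedAddCommGroup Y] [NormedSpace ℝ Y] [FiniteDimensional ℝ Y]

/-- **SMOOTH LOCAL LEFT INVERSE OF AN IMMERSION GERM.**  If `Φ : X → Y` (finite-dimensional real spaces) is of class `C^n`, `n ≥ 1`, on an open set containing `p` and its derivative at
`p` is INJECTIVE, then there are an open `V ∋ Φ p` and `λ : Y → X` of class `C^n` on `V` with `λ (Φ x) = x` for all `x` near `p`.  Proof: a linear retraction `π : Y → X` of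
`DΦ(p)` makes `π ∘ Φ` a local diffeomorphism at `p` (Mathlib `HasStrictFDerivAt.toOpenPartialHomeomorph`); `λ := (π ∘ Φ)⁻¹_loc ∘ π`, smooth on the part of the target where the derivative of
`π ∘ Φ` at the inverse point is still an isomorphism (`OpenPartialHomeomorph.contDiffAt_symm`, `ContinuousLinearEquiv.nhds`). [cite: Lee2012, Thm. 4.12; Prop. 4.1] -/
private theorem exists_contDiffOn_leftInverse_of_injective_fderiv' {n : WithTop ℕ∞} (hn : 1 ≤ n) {Φ : X → Y} {O : Set X} (hO : IsOpen O) {p : X} (hp : p ∈ O)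
    (hΦ : ContDiffOn ℝ n Φ O) (hinj : Injective (fderiv ℝ Φ p)) :
    ∃ V : Set Y, IsOpen V ∧ Φ p ∈ V ∧ ∃ lam : Y → X, ContDiffOn ℝ n lam V ∧ ∀ᶠ x in 𝓝 p, lam (Φ x) = x := by
  have hn0 : n ≠ 0 := by
    intro h; rw [h] at hn; exact absurd hn (by norm_num)
  -- a continuous linear retraction of the injective derivative
  set D : X →L[ℝ] Y := fderiv ℝ Φ p with hD
  obtain ⟨π₀, hπ₀⟩ := (D : X →ₗ[ℝ] Y).exists_leftInverse_of_injective (LinearMap.ker_eq_bot.2 hinj)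
  set π : Y →L[ℝ] X := LinearMap.toContinuousLinearMap π₀ with hπ
  have hπD : π.comp D = ContinuousLinearMap.id ℝ X := by
    ext x
    have := LinearMap.congr_fun hπ₀ x
    simpa [hπ] using this
  -- `f := π ∘ Φ` has derivative `id` at `p`
  set f : X → X := fun x => π (Φ x) with hf
  have hΦp : ContDiffAt ℝ n Φ p := hΦ.contDiffAt (hO.mem_nhds hp)
  have hfO : ContDiffOn ℝ n f O := π.contDiff.comp_contDiffOn hΦ
  have hfp : ContDiffAt ℝ n f p := hfO.contDiffAt (hO.mem_nhds hp)
  have hDf : HasFDerivAt f ((ContinuousLinearEquiv.refl ℝ X : X ≃L[ℝ] X) : X →L[ℝ] X) p := by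
    have h1 : HasFDerivAt Φ D p := (hΦp.differentiableAt hn0).hasFDerivAt
    have h2 : HasFDerivAt f (π.comp D) p := π.hasFDerivAt.comp p h1
    rw [hπD] at h2
    simpa using h2
  have hstrict : HasStrictFDerivAt f ((ContinuousLinearEquiv.refl ℝ X : X ≃L[ℝ] X) : X →L[ℝ] X) p := hfp.hasStrictFDerivAt' hDf hn0
  set e := hstrict.toOpenPartialHomeomorph f with he
  have he_coe : (e : X → X) = f := hstrict.toOpenPartialHomeomorph_coe
  have hpe : p ∈ e.source := hstrict.mem_toOpenPartialHomeomorph_source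
  have hfpe : f p ∈ e.target := hstrict.image_mem_toOpenPartialHomeomorph_target
  -- the derivative of `f` is an isomorphism NEAR `p` (open condition), inside `O ∩ e.source`
  have hcontD : ContinuousOn (fun x => fderiv ℝ f x) O := hfO.continuousOn_fderiv_of_isOpen hO hn
  set G : Set X := {x | x ∈ O ∩ e.source ∧ ∃ e' : X ≃L[ℝ] X, (e' : X →L[ℝ] X) = fderiv ℝ f x} with hG
  have hGopen : IsOpen G := by
    have h1 : IsOpen (O ∩ e.source) := hO.inter e.open_source
    have h2 : IsOpen (O ∩ (fun x => fderiv ℝ f x) ⁻¹' {L : X →L[ℝ] X | ∃ e' : X ≃L[ℝ] X, (e' : X →L[ℝ] X) = L}) := by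
      refine hcontD.isOpen_inter_preimage hO ?_
      -- the set of invertible maps is open
      rw [isOpen_iff_mem_nhds]
      rintro L ⟨e', rfl⟩
      exact e'.nhds
    have : G = (O ∩ e.source) ∩ (O ∩ (fun x => fderiv ℝ f x) ⁻¹' {L : X →L[ℝ] X | ∃ e' : X ≃L[ℝ] X, (e' : X →L[ℝ] X) = L}) := by
      ext x
      simp only [hG, mem_setOf_eq, mem_inter_iff, mem_preimage]
      tauto
    rw [this]
    exact h1.inter h2
  have hpG : p ∈ G := ⟨⟨hp, hpe⟩, ContinuousLinearEquiv.refl ℝ X, by rw [hDf.fderiv]⟩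
  -- the good part of the target
  set V₀ : Set X := e.target ∩ e.symm ⁻¹' G with hV₀
  have hV₀open : IsOpen V₀ := e.isOpen_inter_preimage_symm hGopen
  have hfpV₀ : f p ∈ V₀ := by
    refine ⟨hfpe, ?_⟩
    show e.symm (f p) ∈ G
    rw [← he_coe, e.left_inv hpe]
    exact hpG
  have hsymm : ContDiffOn ℝ n e.symm V₀ := by
    intro y hy
    have hyG : e.symm y ∈ G := hy.2
    obtain ⟨⟨hyO, _⟩, e', he'⟩ := hyG
    have hd : HasFDerivAt e (e' : X →L[ℝ] X) (e.symm y) := by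
      rw [he_coe, he']
      exact ((hfO.contDiffAt (hO.mem_nhds hyO)).differentiableAt hn0).hasFDerivAt
    have hc : ContDiffAt ℝ n e (e.symm y) := by
      rw [he_coe]; exact hfO.contDiffAt (hO.mem_nhds hyO)
    exact (e.contDiffAt_symm hy.1 hd hc).contDiffWithinAt
  -- `λ := e.symm ∘ π` on `V := π ⁻¹' V₀`
  refine ⟨π ⁻¹' V₀, hV₀open.preimage π.continuous, by simpa [hf] using hfpV₀, fun y => e.symm (π y),
    hsymm.comp π.contDiff.contDiffOn (fun y hy => hy), ?_⟩
  filter_upwards [e.open_source.mem_nhds hpe] with x hx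
  have := e.left_inv hx
  rwa [he_coe] at this

variable {E : Type*} [NormedAddCommGroup E] [NormedSpace ℝ E]

/-- **PUSH-FORWARD ALONG AN IMMERSION GERM, UNIFORMLY IN THE GERM.**  `Φ : X → Y` of class `C^n` (`n : ℕ∞`, `n ≥ 1`) on an open `O ∋ p` with injective derivative at `p` ⟹ there is
ONE neighbourhood `N` of `p` (depending on `Φ` only) such that EVERY global `C^n` map `H : X → E` is, on `N`, the pull-back `U ∘ Φ` of some GLOBAL `C^n` map `U : Y → E`
(`U := ρ • (H ∘ λ)` with `λ` the local left inverse of §2 and `ρ` a bump `= 1` near `Φ p` supported where `λ` is smooth — both chosen before `H`). [cite: Lee2012, Thm. 4.12; Lemma 2.26] -/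
private theorem exists_nhds_forall_contDiff_comp_eq_of_injective_fderiv' {n : ℕ∞} (hn : 1 ≤ n) {Φ : X → Y} {O : Set X} (hO : IsOpen O) {p : X} (hp : p ∈ O)
    (hΦ : ContDiffOn ℝ n Φ O) (hinj : Injective (fderiv ℝ Φ p)) :
    ∃ N ∈ 𝓝 p, ∀ H : X → E, ContDiff ℝ n H → ∃ U : Y → E, ContDiff ℝ n U ∧ ∀ x ∈ N, U (Φ x) = H x := by
  have hn' : (1 : WithTop ℕ∞) ≤ (n : WithTop ℕ∞) := by exact_mod_cast hn
  obtain ⟨V, hV, hpV, lam, hlam, hleft⟩ := exists_contDiffOn_leftInverse_of_injective_fderiv' hn' hO hp hΦ hinj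
  -- a bump on `Y`, `= 1` near `Φ p`, supported in `V`
  obtain ⟨r, hr, hrV⟩ : ∃ r > 0, closedBall (Φ p) (2 * r) ⊆ V := by
    obtain ⟨r, hr, hrV⟩ := Metric.isOpen_iff.1 hV (Φ p) hpV
    refine ⟨r / 4, by positivity, (closedBall_subset_ball (by linarith)).trans hrV⟩
  let ρ : ContDiffBump (Φ p) := ⟨r, 2 * r, hr, by linarith⟩
  have hΦc : ContinuousAt Φ p := (hΦ.contDiffAt (hO.mem_nhds hp)).continuousAt
  refine ⟨{x | lam (Φ x) = x} ∩ Φ ⁻¹' ball (Φ p) r, inter_mem hleft (hΦc.preimage_mem_nhds (ball_mem_nhds _ hr)), fun H hH => ?_⟩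
  refine ⟨fun y => ρ y • H (lam y), ?_, fun x hx => ?_⟩
  · rw [contDiff_iff_contDiffAt]
    intro y
    by_cases hy : y ∈ V
    · exact ρ.contDiff.contDiffAt.smul (hH.contDiffAt.comp y (hlam.contDiffAt (hV.mem_nhds hy)))
    · have hy' : y ∉ tsupport (ρ : Y → ℝ) := fun h => hy (hrV (by simpa [ρ.tsupport_eq] using h))
      have h0 : (fun y => ρ y • H (lam y)) =ᶠ[𝓝 y] fun _ => 0 := by
        have : (ρ : Y → ℝ) =ᶠ[𝓝 y] 0 := by
          rw [← notMem_tsupport_iff_eventuallyEq]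
          exact hy'
        filter_upwards [this] with z hz
        simp only [hz, Pi.zero_apply, zero_smul]
      exact (contDiffAt_const (c := (0 : E))).congr_of_eventuallyEq h0
  · obtain ⟨hx1, hx2⟩ := hx
    have hρ : ρ (Φ x) = 1 := ρ.one_of_mem_closedBall (ball_subset_closedBall hx2)
    show ρ (Φ x) • H (lam (Φ x)) = H x
    rw [hρ, one_smul, hx1]


end ImmersionPrivate2


/-! ## §1 The even profile `g` of `cos`/`cosh`: value and derivative at `0`, and `sin ν = −2ν·g′(ν²)`, `sinh x = −2x·g′(−x²)` -/

section Profile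

variable {g : ℝ → ℝ} (hg : ContDiff ℝ ∞ g) (hcos : ∀ ν : ℝ, Real.cos ν = g (ν ^ 2))
include hg hcos

omit hg in
/-- `g(0) = 1` (from `cos 0 = g(0)`). [cite: Bouaziz1994IntegralesOrbitales, §4 pp. 585–586] -/
theorem profile_zero : g 0 = 1 := by
  have h := hcos 0
  simp at h
  exact h.symm

/-- `sin ν = -2 ν g′(ν²)`. [cite: Bouaziz1994IntegralesOrbitales, §4 pp. 585–586] -/
theorem sin_eq_neg_two_mul_mul_deriv (ν : ℝ) : Real.sin ν = -2 * ν * deriv g (ν ^ 2) := by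
  have hgd : Differentiable ℝ g := hg.differentiable (by simp)
  have h1 : HasDerivAt (fun ν : ℝ => g (ν ^ 2)) (deriv g (ν ^ 2) * (2 * ν)) ν := by
    have hsq : HasDerivAt (fun ν : ℝ => ν ^ 2) (2 * ν) ν := by
      simpa using hasDerivAt_pow 2 ν
    exact (hgd (ν ^ 2)).hasDerivAt.comp ν hsq
  have h2 : HasDerivAt (fun ν : ℝ => g (ν ^ 2)) (-Real.sin ν) ν := by
    have := Real.hasDerivAt_cos ν
    refine this.congr_of_eventuallyEq ?_
    exact Filter.Eventually.of_forall fun x => (hcos x).symm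
  have := h1.unique h2
  linarith

/-- `g′(0) = -1/2`. [cite: Bouaziz1994IntegralesOrbitales, §4 pp. 585–586] -/
theorem deriv_profile_zero : deriv g 0 = -1 / 2 := by
  have hgd : Differentiable ℝ g := hg.differentiable (by simp)
  have hg'd : Differentiable ℝ (deriv g) := by
    have : ContDiff ℝ ∞ (deriv g) := hg.deriv'
    exact this.differentiable (by simp)
  -- differentiate `-sin ν = 2 ν g′(ν²)` at `0`
  have h1 : HasDerivAt (fun ν : ℝ => 2 * ν * deriv g (ν ^ 2)) (2 * deriv g 0) 0 := by
    have hb : HasDerivAt (fun ν : ℝ => deriv g (ν ^ 2)) (deriv (deriv g) (0 ^ 2) * (2 * 0)) 0 := by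
      have hsq : HasDerivAt (fun ν : ℝ => ν ^ 2) (2 * (0 : ℝ)) 0 := by simpa using hasDerivAt_pow 2 (0 : ℝ)
      exact (hg'd _).hasDerivAt.comp 0 hsq
    have := ((hasDerivAt_id (0 : ℝ)).mul hb).const_mul 2
    simpa [mul_assoc] using this
  have h2 : HasDerivAt (fun ν : ℝ => 2 * ν * deriv g (ν ^ 2)) (-Real.cos 0) 0 := by
    have := (Real.hasDerivAt_sin 0).neg
    refine this.congr_of_eventuallyEq (Filter.Eventually.of_forall fun x => ?_)
    have hx := sin_eq_neg_two_mul_mul_deriv hg hcos x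
    show 2 * x * deriv g (x ^ 2) = (-Real.sin) x
    simp only [Pi.neg_apply]
    linarith
  have := h1.unique h2
  simp at this
  linarith

end Profile

section ProfileCosh

variable {g : ℝ → ℝ} (hg : ContDiff ℝ ∞ g) (hcosh : ∀ x : ℝ, Real.cosh x = g (-(x ^ 2)))
include hg hcosh

/-- `sinh x = -2 x g′(-x²)`. [cite: Bouaziz1994IntegralesOrbitales, §4 pp. 585–586] -/
theorem sinh_eq_neg_two_mul_mul_deriv (x : ℝ) : Real.sinh x = -2 * x * deriv g (-(x ^ 2)) := by
  have hgd : Differentiable ℝ g := hg.differentiable (by simp)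
  have h1 : HasDerivAt (fun x : ℝ => g (-(x ^ 2))) (deriv g (-(x ^ 2)) * (-(2 * x))) x := by
    have hsq : HasDerivAt (fun x : ℝ => -(x ^ 2)) (-(2 * x)) x := by
      simpa using (hasDerivAt_pow 2 x).const_mul (-1)
    exact (hgd _).hasDerivAt.comp x hsq
  have h2 : HasDerivAt (fun x : ℝ => g (-(x ^ 2))) (Real.sinh x) x := by
    refine (Real.hasDerivAt_cosh x).congr_of_eventuallyEq (Filter.Eventually.of_forall fun y => (hcosh y).symm)
  have := h1.unique h2
  linarith

omit hg in
/-- `eˣ + e⁻ˣ = 2 g(−x²)`. [cite: Bouaziz1994IntegralesOrbitales, §4 pp. 585–586] -/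
theorem exp_add_exp_neg_eq (x : ℝ) : Real.exp x + Real.exp (-x) = 2 * g (-(x ^ 2)) := by
  rw [← hcosh x, Real.cosh_eq]; ring

end ProfileCosh

/-! ## §2 Trigonometric identities for the compact block -/

/-- `e^{i(u+v)} + e^{i(u−v)} = 2 cos v · e^{iu}`. [cite: Bouaziz1994IntegralesOrbitales, §4 pp. 585–586] -/
theorem coe_circleExp_add_coe_circleExp_aux (u v : ℝ) :
    (Circle.exp (u + v) : ℂ) + (Circle.exp (u - v) : ℂ) = 2 * (Real.cos v : ℂ) * (Circle.exp u : ℂ) := by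
  simp only [Circle.coe_exp, Complex.ofReal_add, Complex.ofReal_sub, Complex.exp_mul_I, Complex.cos_add, Complex.sin_add,
    Complex.cos_sub, Complex.sin_sub, Complex.ofReal_cos]
  ring

/-- The trace of a compact block: `e^{ia} + e^{ic} = 2 cos((a−c)/2) · e^{i(a+c)/2}`. [cite: Bouaziz1994IntegralesOrbitales, §4 pp. 585–586] -/
theorem coe_circleExp_add_coe_circleExp (a c : ℝ) :
    (Circle.exp a : ℂ) + (Circle.exp c : ℂ) = 2 * (Real.cos ((a - c) / 2) : ℂ) * (Circle.exp ((a + c) / 2) : ℂ) := by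
  have h := coe_circleExp_add_coe_circleExp_aux ((a + c) / 2) ((a - c) / 2)
  rwa [show (a + c) / 2 + (a - c) / 2 = a by ring, show (a + c) / 2 - (a - c) / 2 = c by ring] at h

/-- The determinant of a compact block: `e^{ia} · e^{ic} = (e^{i(a+c)/2})²`. [cite: Bouaziz1994IntegralesOrbitales, §4 pp. 585–586] -/
theorem coe_circleExp_mul_coe_circleExp (a c : ℝ) :
    (Circle.exp a : ℂ) * (Circle.exp c : ℂ) = (Circle.exp ((a + c) / 2) : ℂ) ^ 2 := by
  rw [sq, ← Circle.coe_mul, ← Circle.coe_mul, ← Circle.exp_add, ← Circle.exp_add]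
  congr 2
  ring

/-! ## §3 One-variable derivatives of the block entries -/

section LineDerivs

/-- `d/ds e^{iφ(s)} = e^{iφ(s)} · iφ′(s)`. [cite: Bouaziz1994IntegralesOrbitales, §4 pp. 585–586] -/
theorem hasDerivAt_coe_circleExp_comp {φ : ℝ → ℝ} {φ' s : ℝ} (h : HasDerivAt φ φ' s) :
    HasDerivAt (fun s => (Circle.exp (φ s) : ℂ)) ((Circle.exp (φ s) : ℂ) * ((φ' : ℂ) * I)) s := by
  simp_rw [Circle.coe_exp]
  exact (h.ofReal_comp.mul_const I).cexp

/-- `d/ds (e^{iφ(s)})² = 2 e^{iφ} · e^{iφ} iφ′`. [cite: Bouaziz1994IntegralesOrbitales, §4 pp. 585–586] -/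
theorem hasDerivAt_coe_circleExp_comp_sq {φ : ℝ → ℝ} {φ' s : ℝ} (h : HasDerivAt φ φ' s) :
    HasDerivAt (fun s => (Circle.exp (φ s) : ℂ) ^ 2) (2 * (Circle.exp (φ s) : ℂ) * ((Circle.exp (φ s) : ℂ) * ((φ' : ℂ) * I))) s := by
  have h' := hasDerivAt_coe_circleExp_comp h
  have h2 : HasDerivAt (fun s => (Circle.exp (φ s) : ℂ) * (Circle.exp (φ s) : ℂ))
      ((Circle.exp (φ s) : ℂ) * ((φ' : ℂ) * I) * (Circle.exp (φ s) : ℂ) + (Circle.exp (φ s) : ℂ) * ((Circle.exp (φ s) : ℂ) * ((φ' : ℂ) * I))) s :=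
    h'.mul h'
  refine (h2.congr_of_eventuallyEq (Filter.Eventually.of_forall fun s => sq _)).congr_deriv ?_
  ring

/-- `d/ds [2 g(Q s) e^{i T s}] = 2 g′(Q)Q′ e^{iT} + 2 g(Q) e^{iT} iT′`. [cite: Bouaziz1994IntegralesOrbitales, §4 pp. 585–586] -/
theorem hasDerivAt_two_mul_comp_mul_coe_circleExp {g : ℝ → ℝ} (hgd : Differentiable ℝ g) {Q T : ℝ → ℝ} {q σ s : ℝ} (hQ : HasDerivAt Q q s) (hT : HasDerivAt T σ s) :
    HasDerivAt (fun s => 2 * ((g (Q s) : ℝ) : ℂ) * (Circle.exp (T s) : ℂ))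
      (2 * ((deriv g (Q s) * q : ℝ) : ℂ) * (Circle.exp (T s) : ℂ) + 2 * ((g (Q s) : ℝ) : ℂ) * ((Circle.exp (T s) : ℂ) * ((σ : ℂ) * I))) s := by
  have h1 : HasDerivAt (fun s => ((g (Q s) : ℝ) : ℂ)) (((deriv g (Q s) * q : ℝ)) : ℂ) s :=
    ((hgd (Q s)).hasDerivAt.comp s hQ).ofReal_comp
  have h2 := hasDerivAt_coe_circleExp_comp hT
  have h3 : HasDerivAt (fun s => ((g (Q s) : ℝ) : ℂ) * (Circle.exp (T s) : ℂ))
      ((((deriv g (Q s) * q : ℝ)) : ℂ) * (Circle.exp (T s) : ℂ) + ((g (Q s) : ℝ) : ℂ) * ((Circle.exp (T s) : ℂ) * ((σ : ℂ) * I))) s := h1.mul h2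
  have h4 := h3.const_mul (2 : ℂ)
  refine (h4.congr_of_eventuallyEq (Filter.Eventually.of_forall fun s => ?_)).congr_deriv ?_
  · show 2 * ((g (Q s) : ℝ) : ℂ) * (Circle.exp (T s) : ℂ) = 2 * (((g (Q s) : ℝ) : ℂ) * (Circle.exp (T s) : ℂ))
    ring
  · ring

/-- The coordinate line `s ↦ (v₀ + s • k) i = v₀ i + s · k i`. [cite: Bouaziz1994IntegralesOrbitales, §4 pp. 585–586] -/
theorem hasDerivAt_line_apply (v₀ k : Fin 3 → ℝ) (i : Fin 3) (s : ℝ) : HasDerivAt (fun s : ℝ => (v₀ + s • k) i) (k i) s := by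
  have : HasDerivAt (fun s : ℝ => v₀ i + s * k i) (k i) s := by
    simpa using ((hasDerivAt_id' s).mul_const (k i)).const_add (v₀ i)
  simpa [Pi.add_apply, Pi.smul_apply, smul_eq_mul] using this

end LineDerivs

/-! ## §4 Injectivity of the block derivatives -/

section Blocks

/-- The `u`-entry kills `k 1`: if `s ↦ e^{i (v₀ + s k)_1}` has derivative `0` at `s`, then `k 1 = 0`. [cite: Bouaziz1994IntegralesOrbitales, §4 pp. 585–586] -/
theorem apply_one_eq_zero_of_hasDerivAt_u (v₀ k : Fin 3 → ℝ) {s : ℝ}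
    (h : HasDerivAt (fun s : ℝ => (Circle.exp ((v₀ + s • k) 1) : ℂ)) 0 s) : k 1 = 0 := by
  have h' := hasDerivAt_coe_circleExp_comp (hasDerivAt_line_apply v₀ k 1 s)
  have h0 := h'.unique h
  have hE : (Circle.exp ((v₀ + s • k) 1) : ℂ) ≠ 0 := Circle.coe_ne_zero _
  have : ((k 1 : ℝ) : ℂ) = 0 := by
    rcases mul_eq_zero.1 h0 with h0 | h0
    · exact absurd h0 hE
    · exact (mul_eq_zero.1 h0).resolve_right Complex.I_ne_zero
  exact_mod_cast this

/-- The `det`-entry kills the derivative of its phase: `s ↦ (e^{i T(s)})²` with derivative `0` forces `T′ = 0`. [cite: Bouaziz1994IntegralesOrbitales, §4 pp. 585–586] -/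
theorem phase_deriv_eq_zero_of_hasDerivAt_det {T : ℝ → ℝ} {σ s : ℝ} (hT : HasDerivAt T σ s)
    (h : HasDerivAt (fun s : ℝ => (Circle.exp (T s) : ℂ) ^ 2) 0 s) : σ = 0 := by
  have h0 := (hasDerivAt_coe_circleExp_comp_sq hT).unique h
  have hE : (Circle.exp (T s) : ℂ) ≠ 0 := Circle.coe_ne_zero _
  have : ((σ : ℝ) : ℂ) = 0 := by
    simp only [mul_eq_zero, Complex.I_ne_zero, or_false, hE, false_or, OfNat.ofNat_ne_zero] at h0
    exact h0
  exact_mod_cast this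

/-- The `tr`-entry, once the phase is stationary: `s ↦ 2 g(Q s) e^{i T s}` with derivative `0` and `T′ = 0` forces `g′(Q s) · Q′ = 0`. [cite: Bouaziz1994IntegralesOrbitales, §4 pp. 585–586] -/
theorem deriv_mul_eq_zero_of_hasDerivAt_tr {g : ℝ → ℝ} (hgd : Differentiable ℝ g) {Q T : ℝ → ℝ} {q s : ℝ} (hQ : HasDerivAt Q q s) (hT : HasDerivAt T 0 s)
    (h : HasDerivAt (fun s : ℝ => 2 * ((g (Q s) : ℝ) : ℂ) * (Circle.exp (T s) : ℂ)) 0 s) : deriv g (Q s) * q = 0 := by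
  have h0 := (hasDerivAt_two_mul_comp_mul_coe_circleExp hgd hQ hT).unique h
  have hE : (Circle.exp (T s) : ℂ) ≠ 0 := Circle.coe_ne_zero _
  simp only [Complex.ofReal_zero, zero_mul, mul_zero, add_zero, mul_eq_zero, hE, or_false, OfNat.ofNat_ne_zero, false_or] at h0
  exact_mod_cast h0

/-- A vector in `ℝ³` vanishes once its three coordinates do. [cite: Bouaziz1994IntegralesOrbitales, §4 pp. 585–586] -/
theorem fin3_eq_zero {k : Fin 3 → ℝ} (h0 : k 0 = 0) (h1 : k 1 = 0) (h2 : k 2 = 0) : k = 0 := by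
  funext i; fin_cases i <;> assumption

variable {g : ℝ → ℝ} (hg : ContDiff ℝ ∞ g) (hcos : ∀ ν : ℝ, Real.cos ν = g (ν ^ 2))
include hg hcos

/-- **COMPACT CENTRAL BLOCK** (a place of `P`, chart point ON the wall `v₀ 0 = v₀ 2`, squared-coordinate model `(2 g((v0 − v2)/2) e^{iσ}, e^{2iσ}, e^{i v1})`,
`σ = (v0 + v2)/2`): the derivative along any line through `v₀` vanishes only for the zero direction (uses `g′(0) = −1/2 ≠ 0`). [cite: Bouaziz1994IntegralesOrbitales, §4 pp. 585–586] [cite: Lee2012, Thm. 4.12] -/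
theorem eq_zero_of_hasDerivAt_compactCentralBlock (v₀ k : Fin 3 → ℝ) (hv : v₀ 0 = v₀ 2)
    (h1 : HasDerivAt (fun s : ℝ => 2 * ((g (((v₀ + s • k) 0 - (v₀ + s • k) 2) / 2) : ℝ) : ℂ) * (Circle.exp (((v₀ + s • k) 0 + (v₀ + s • k) 2) / 2) : ℂ)) 0 0)
    (h2 : HasDerivAt (fun s : ℝ => (Circle.exp (((v₀ + s • k) 0 + (v₀ + s • k) 2) / 2) : ℂ) ^ 2) 0 0)
    (h3 : HasDerivAt (fun s : ℝ => (Circle.exp ((v₀ + s • k) 1) : ℂ)) 0 0) : k = 0 := by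
  have hgd : Differentiable ℝ g := hg.differentiable (by simp)
  have hQ : HasDerivAt (fun s : ℝ => ((v₀ + s • k) 0 - (v₀ + s • k) 2) / 2) ((k 0 - k 2) / 2) 0 :=
    ((hasDerivAt_line_apply v₀ k 0 0).sub (hasDerivAt_line_apply v₀ k 2 0)).div_const 2
  have hT : HasDerivAt (fun s : ℝ => ((v₀ + s • k) 0 + (v₀ + s • k) 2) / 2) ((k 0 + k 2) / 2) 0 :=
    ((hasDerivAt_line_apply v₀ k 0 0).add (hasDerivAt_line_apply v₀ k 2 0)).div_const 2
  have hσ : (k 0 + k 2) / 2 = 0 := phase_deriv_eq_zero_of_hasDerivAt_det hT h2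
  rw [hσ] at hT
  have hq := deriv_mul_eq_zero_of_hasDerivAt_tr hgd hQ hT h1
  have hQ0 : ((v₀ + (0 : ℝ) • k) 0 - (v₀ + (0 : ℝ) • k) 2) / 2 = 0 := by simp [hv]
  rw [hQ0, deriv_profile_zero hg hcos] at hq
  have hk1 := apply_one_eq_zero_of_hasDerivAt_u v₀ k h3
  have ha : k 0 - k 2 = 0 := by linarith
  have hb : k 0 + k 2 = 0 := by linarith
  exact fin3_eq_zero (by linarith) hk1 (by linarith)

/-- **COMPACT REGULAR BLOCK** (a place off `S` and off `P`: distinct eigenvalues `e^{i v₀ 0} ≠ e^{i v₀ 2}`, model = the class map itself `(2 g(((v0 − v2)/2)²) e^{iσ}, e^{2iσ}, e^{i v1})`):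
the derivative along any line through `v₀` vanishes only for the zero direction (uses `2ψ₀ g′(ψ₀²) = −sin ψ₀ ≠ 0`). [cite: Bouaziz1994IntegralesOrbitales, §4 pp. 585–586] [cite: Lee2012, Thm. 4.12] -/
theorem eq_zero_of_hasDerivAt_compactRegularBlock (v₀ k : Fin 3 → ℝ) (hv : Circle.exp (v₀ 0) ≠ Circle.exp (v₀ 2))
    (h1 : HasDerivAt (fun s : ℝ => 2 * ((g ((((v₀ + s • k) 0 - (v₀ + s • k) 2) / 2) ^ 2) : ℝ) : ℂ) * (Circle.exp (((v₀ + s • k) 0 + (v₀ + s • k) 2) / 2) : ℂ)) 0 0)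
    (h2 : HasDerivAt (fun s : ℝ => (Circle.exp (((v₀ + s • k) 0 + (v₀ + s • k) 2) / 2) : ℂ) ^ 2) 0 0)
    (h3 : HasDerivAt (fun s : ℝ => (Circle.exp ((v₀ + s • k) 1) : ℂ)) 0 0) : k = 0 := by
  have hgd : Differentiable ℝ g := hg.differentiable (by simp)
  set ψ₀ : ℝ := (v₀ 0 - v₀ 2) / 2 with hψ₀
  have hQ' : HasDerivAt (fun s : ℝ => ((v₀ + s • k) 0 - (v₀ + s • k) 2) / 2) ((k 0 - k 2) / 2) 0 :=
    ((hasDerivAt_line_apply v₀ k 0 0).sub (hasDerivAt_line_apply v₀ k 2 0)).div_const 2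
  have hQ : HasDerivAt (fun s : ℝ => (((v₀ + s • k) 0 - (v₀ + s • k) 2) / 2) ^ 2) (2 * ψ₀ * ((k 0 - k 2) / 2)) 0 := by
    refine ((hQ'.pow 2).congr_of_eventuallyEq (Filter.Eventually.of_forall fun s => rfl)).congr_deriv ?_
    simp [hψ₀]
  have hT : HasDerivAt (fun s : ℝ => ((v₀ + s • k) 0 + (v₀ + s • k) 2) / 2) ((k 0 + k 2) / 2) 0 :=
    ((hasDerivAt_line_apply v₀ k 0 0).add (hasDerivAt_line_apply v₀ k 2 0)).div_const 2
  have hσ : (k 0 + k 2) / 2 = 0 := phase_deriv_eq_zero_of_hasDerivAt_det hT h2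
  rw [hσ] at hT
  have hq := deriv_mul_eq_zero_of_hasDerivAt_tr hgd hQ hT h1
  have hQ0 : (((v₀ + (0 : ℝ) • k) 0 - (v₀ + (0 : ℝ) • k) 2) / 2) ^ 2 = ψ₀ ^ 2 := by simp [hψ₀]
  rw [hQ0] at hq
  -- `2 ψ₀ g′(ψ₀²) = -sin ψ₀ ≠ 0`
  have hsin : Real.sin ψ₀ ≠ 0 := by
    intro h0
    obtain ⟨n, hn⟩ := Real.sin_eq_zero_iff.1 h0
    rw [hψ₀] at hn
    exact (circleExp_ne_iff_forall_int (v₀ 0) (v₀ 2)).1 hv n (by linarith)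
  have hne : 2 * ψ₀ * deriv g (ψ₀ ^ 2) ≠ 0 := by
    rw [show 2 * ψ₀ * deriv g (ψ₀ ^ 2) = -Real.sin ψ₀ by rw [sin_eq_neg_two_mul_mul_deriv hg hcos ψ₀]; ring]
    exact neg_ne_zero.2 hsin
  have hk02 : k 0 - k 2 = 0 := by
    have : deriv g (ψ₀ ^ 2) * (2 * ψ₀ * ((k 0 - k 2) / 2)) = (2 * ψ₀ * deriv g (ψ₀ ^ 2)) * ((k 0 - k 2) / 2) := by ring
    rw [this] at hq
    have := (mul_eq_zero.1 hq).resolve_left hne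
    linarith
  have hk1 := apply_one_eq_zero_of_hasDerivAt_u v₀ k h3
  exact fin3_eq_zero (by linarith) hk1 (by linarith)

end Blocks

section SplitBlocks

variable {g : ℝ → ℝ} (hg : ContDiff ℝ ∞ g) (hcos : ∀ ν : ℝ, Real.cos ν = g (ν ^ 2)) (hcosh : ∀ x : ℝ, Real.cosh x = g (-(x ^ 2)))
include hg

include hcos in
/-- **SPLIT CENTRAL BLOCK** (a place of `T`, chart point ON the wall `v₀ 0 = 0`, squared-coordinate model `(2 g(−v0) e^{i v2}, e^{2 i v2}, e^{i v1})`): the derivative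
along any line through `v₀` vanishes only for the zero direction (uses `g′(0) ≠ 0`). [cite: Bouaziz1994IntegralesOrbitales, §4 pp. 585–586] [cite: Lee2012, Thm. 4.12] -/
theorem eq_zero_of_hasDerivAt_splitCentralBlock (v₀ k : Fin 3 → ℝ) (hv : v₀ 0 = 0)
    (h1 : HasDerivAt (fun s : ℝ => 2 * ((g (-((v₀ + s • k) 0)) : ℝ) : ℂ) * (Circle.exp ((v₀ + s • k) 2) : ℂ)) 0 0)
    (h2 : HasDerivAt (fun s : ℝ => (Circle.exp ((v₀ + s • k) 2) : ℂ) ^ 2) 0 0)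
    (h3 : HasDerivAt (fun s : ℝ => (Circle.exp ((v₀ + s • k) 1) : ℂ)) 0 0) : k = 0 := by
  have hgd : Differentiable ℝ g := hg.differentiable (by simp)
  have hQ : HasDerivAt (fun s : ℝ => -((v₀ + s • k) 0)) (-k 0) 0 := (hasDerivAt_line_apply v₀ k 0 0).neg
  have hT : HasDerivAt (fun s : ℝ => (v₀ + s • k) 2) (k 2) 0 := hasDerivAt_line_apply v₀ k 2 0
  have hσ : k 2 = 0 := phase_deriv_eq_zero_of_hasDerivAt_det hT h2
  rw [hσ] at hT
  have hq := deriv_mul_eq_zero_of_hasDerivAt_tr hgd hQ hT h1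
  have hQ0 : -((v₀ + (0 : ℝ) • k) 0) = 0 := by simp [hv]
  rw [hQ0, deriv_profile_zero hg hcos] at hq
  have hk1 := apply_one_eq_zero_of_hasDerivAt_u v₀ k h3
  exact fin3_eq_zero (by linarith) hk1 hσ

include hcosh in
/-- **SPLIT REGULAR BLOCK** (a place of `S ∖ T`, `v₀ 0 ≠ 0`, model = the class map itself `(2 g(−v0²) e^{i v2}, e^{2 i v2}, e^{i v1})`): the derivative along any line through `v₀`
vanishes only for the zero direction (uses `−2x g′(−x²) = sinh x ≠ 0`). [cite: Bouaziz1994IntegralesOrbitales, §4 pp. 585–586] [cite: Lee2012, Thm. 4.12] -/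
theorem eq_zero_of_hasDerivAt_splitRegularBlock (v₀ k : Fin 3 → ℝ) (hv : v₀ 0 ≠ 0)
    (h1 : HasDerivAt (fun s : ℝ => 2 * ((g (-(((v₀ + s • k) 0) ^ 2)) : ℝ) : ℂ) * (Circle.exp ((v₀ + s • k) 2) : ℂ)) 0 0)
    (h2 : HasDerivAt (fun s : ℝ => (Circle.exp ((v₀ + s • k) 2) : ℂ) ^ 2) 0 0)
    (h3 : HasDerivAt (fun s : ℝ => (Circle.exp ((v₀ + s • k) 1) : ℂ)) 0 0) : k = 0 := by
  have hgd : Differentiable ℝ g := hg.differentiable (by simp)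
  have hQ : HasDerivAt (fun s : ℝ => -(((v₀ + s • k) 0) ^ 2)) (-(2 * v₀ 0 * k 0)) 0 := by
    have := ((hasDerivAt_line_apply v₀ k 0 0).pow 2).neg
    refine (this.congr_of_eventuallyEq (Filter.Eventually.of_forall fun s => rfl)).congr_deriv ?_
    simp
  have hT : HasDerivAt (fun s : ℝ => (v₀ + s • k) 2) (k 2) 0 := hasDerivAt_line_apply v₀ k 2 0
  have hσ : k 2 = 0 := phase_deriv_eq_zero_of_hasDerivAt_det hT h2
  rw [hσ] at hT
  have hq := deriv_mul_eq_zero_of_hasDerivAt_tr hgd hQ hT h1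
  have hQ0 : -(((v₀ + (0 : ℝ) • k) 0) ^ 2) = -((v₀ 0) ^ 2) := by simp
  rw [hQ0] at hq
  have hsinh : Real.sinh (v₀ 0) ≠ 0 := by rwa [Ne, Real.sinh_eq_zero]
  have hne : -2 * v₀ 0 * deriv g (-((v₀ 0) ^ 2)) ≠ 0 := by
    rw [← sinh_eq_neg_two_mul_mul_deriv hg hcosh (v₀ 0)]; exact hsinh
  have hk0 : k 0 = 0 := by
    have : deriv g (-((v₀ 0) ^ 2)) * (-(2 * v₀ 0 * k 0)) = (-2 * v₀ 0 * deriv g (-((v₀ 0) ^ 2))) * k 0 := by ring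
    rw [this] at hq
    exact (mul_eq_zero.1 hq).resolve_left hne
  have hk1 := apply_one_eq_zero_of_hasDerivAt_u v₀ k h3
  exact fin3_eq_zero hk0 hk1 hσ

end SplitBlocks


/-! ## §5 The squared-coordinate model `Φ` of the class map: smoothness, factorisation `Φ ∘ sq = bzClassMap S`, injective differential at a fibre point -/

section Model

variable {W : Type*} [Fintype W] [DecidableEq W]

/-- `z ↦ e^{i f(z)}` is smooth for smooth real `f`. [cite: Bouaziz1994IntegralesOrbitales, §4 pp. 585–586] -/
private theorem contDiff_coe_circleExp_compX {X : Type*} [NormedAddCommGroup X] [NormedSpace ℝ X] {f : X → ℝ} (hf : ContDiff ℝ ∞ f) :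
    ContDiff ℝ ∞ fun z => (Circle.exp (f z) : ℂ) := by
  simp_rw [Circle.coe_exp]
  exact ((Complex.ofRealCLM.contDiff.comp hf).mul contDiff_const).cexp

variable {g : ℝ → ℝ} (hg : ContDiff ℝ ∞ g)
include hg

/-- The squared-coordinate model is smooth. [cite: Bouaziz1994IntegralesOrbitales, §4 pp. 585–586] -/
theorem contDiff_squaredClassModel (S P T : Finset W) :
    ContDiff ℝ ∞ fun (z : W → Fin 3 → ℝ) (w : W) =>
      (if w ∈ S then
        ((2 * ((g (-(if w ∈ T then z w 0 else (z w 0) ^ 2)) : ℝ) : ℂ) * (Circle.exp (z w 2) : ℂ), (Circle.exp (z w 2) : ℂ) ^ 2, (Circle.exp (z w 1) : ℂ)) : ℂ × ℂ × ℂ)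
      else
        (2 * ((g (if w ∈ P then (z w 0 - z w 2) / 2 else ((z w 0 - z w 2) / 2) ^ 2) : ℝ) : ℂ) * (Circle.exp ((z w 0 + z w 2) / 2) : ℂ),
          (Circle.exp ((z w 0 + z w 2) / 2) : ℂ) ^ 2, (Circle.exp (z w 1) : ℂ))) := by
  refine contDiff_pi.2 fun w => ?_
  have hc : ∀ i : Fin 3, ContDiff ℝ ∞ fun z : W → Fin 3 → ℝ => z w i := fun i => contDiff_apply_apply ℝ ℝ w i
  have hgc : ∀ {f : (W → Fin 3 → ℝ) → ℝ}, ContDiff ℝ ∞ f → ContDiff ℝ ∞ fun z => (2 * ((g (f z) : ℝ) : ℂ)) := fun hf =>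
    contDiff_const.mul (Complex.ofRealCLM.contDiff.comp (hg.comp hf))
  by_cases hw : w ∈ S
  · simp only [if_pos hw]
    refine ((hgc ?_).mul (contDiff_coe_circleExp_compX (hc 2))).prodMk
      (((contDiff_coe_circleExp_compX (hc 2)).pow 2).prodMk (contDiff_coe_circleExp_compX (hc 1)))
    by_cases hwT : w ∈ T
    · simp only [if_pos hwT]; exact (hc 0).neg
    · simp only [if_neg hwT]; exact ((hc 0).pow 2).neg
  · simp only [if_neg hw]
    have hσ : ContDiff ℝ ∞ fun z : W → Fin 3 → ℝ => (z w 0 + z w 2) / 2 := ((hc 0).add (hc 2)).div_const 2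
    have hψ : ContDiff ℝ ∞ fun z : W → Fin 3 → ℝ => (z w 0 - z w 2) / 2 := ((hc 0).sub (hc 2)).div_const 2
    refine ((hgc ?_).mul (contDiff_coe_circleExp_compX hσ)).prodMk
      (((contDiff_coe_circleExp_compX hσ).pow 2).prodMk (contDiff_coe_circleExp_compX (hc 1)))
    by_cases hwP : w ∈ P
    · simp only [if_pos hwP]; exact hψ
    · simp only [if_neg hwP]; exact hψ.pow 2

omit hg in
/-- Components of a line with zero derivative in `ℂ × ℂ × ℂ`. [cite: Bouaziz1994IntegralesOrbitales, §4 pp. 585–586] -/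
theorem hasDerivAt_components_of_zero {f : ℝ → ℂ × ℂ × ℂ} {s : ℝ} (h : HasDerivAt f 0 s) :
    HasDerivAt (fun s => (f s).1) 0 s ∧ HasDerivAt (fun s => (f s).2.1) 0 s ∧ HasDerivAt (fun s => (f s).2.2) 0 s := by
  refine ⟨?_, ?_, ?_⟩
  · simpa using h.hasFDerivAt.fst.hasDerivAt
  · simpa using h.hasFDerivAt.snd.fst.hasDerivAt
  · simpa using h.hasFDerivAt.snd.snd.hasDerivAt

variable (hcos : ∀ ν : ℝ, Real.cos ν = g (ν ^ 2)) (hcosh : ∀ x : ℝ, Real.cosh x = g (-(x ^ 2)))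
include hcos hcosh

/-- **THE SQUARED-COORDINATE MODEL IS AN IMMERSION AT A FIBRE POINT**: at `z₀` with `z₀ w 0 = 0` (`w ∈ T`), `z₀ w 0 = z₀ w 2` (`w ∈ P`), `z₀ w 0 ≠ 0` (`w ∈ S ∖ T`) and distinct unit
eigenvalues at the other compact places, the derivative of the model is injective (block by block: §4). [cite: Bouaziz1994IntegralesOrbitales, §4 pp. 585–586] [cite: Lee2012, Thm. 4.12] -/
theorem injective_fderiv_squaredClassModel (S P T : Finset W) {z₀ : W → Fin 3 → ℝ}
    (h0T : ∀ w ∈ T, z₀ w 0 = 0) (h0P : ∀ w ∈ P, z₀ w 0 = z₀ w 2) (hS : ∀ w ∈ S, w ∉ T → z₀ w 0 ≠ 0)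
    (hC : ∀ w, w ∉ S → w ∉ P → Circle.exp (z₀ w 0) ≠ Circle.exp (z₀ w 2)) :
    Function.Injective (fderiv ℝ (fun (z : W → Fin 3 → ℝ) (w : W) =>
      (if w ∈ S then
        ((2 * ((g (-(if w ∈ T then z w 0 else (z w 0) ^ 2)) : ℝ) : ℂ) * (Circle.exp (z w 2) : ℂ), (Circle.exp (z w 2) : ℂ) ^ 2, (Circle.exp (z w 1) : ℂ)) : ℂ × ℂ × ℂ)
      else
        (2 * ((g (if w ∈ P then (z w 0 - z w 2) / 2 else ((z w 0 - z w 2) / 2) ^ 2) : ℝ) : ℂ) * (Circle.exp ((z w 0 + z w 2) / 2) : ℂ),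
          (Circle.exp ((z w 0 + z w 2) / 2) : ℂ) ^ 2, (Circle.exp (z w 1) : ℂ)))) z₀) := by
  set Φ := (fun (z : W → Fin 3 → ℝ) (w : W) =>
      (if w ∈ S then
        ((2 * ((g (-(if w ∈ T then z w 0 else (z w 0) ^ 2)) : ℝ) : ℂ) * (Circle.exp (z w 2) : ℂ), (Circle.exp (z w 2) : ℂ) ^ 2, (Circle.exp (z w 1) : ℂ)) : ℂ × ℂ × ℂ)
      else
        (2 * ((g (if w ∈ P then (z w 0 - z w 2) / 2 else ((z w 0 - z w 2) / 2) ^ 2) : ℝ) : ℂ) * (Circle.exp ((z w 0 + z w 2) / 2) : ℂ),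
          (Circle.exp ((z w 0 + z w 2) / 2) : ℂ) ^ 2, (Circle.exp (z w 1) : ℂ)))) with hΦdef
  have hΦ : ContDiff ℝ ∞ Φ := contDiff_squaredClassModel hg S P T
  rw [injective_iff_map_eq_zero]
  intro h hh
  -- the line through `z₀` in the direction `h` has zero derivative under `Φ`
  have hl : HasDerivAt (fun s : ℝ => z₀ + s • h) h 0 := by
    simpa using ((hasDerivAt_id (0 : ℝ)).smul_const h).const_add z₀
  have hline : HasDerivAt (Φ ∘ fun s : ℝ => z₀ + s • h) ((fderiv ℝ Φ z₀) h) 0 :=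
    ((hΦ.differentiable (by simp)) z₀).hasFDerivAt.comp_hasDerivAt_of_eq (0 : ℝ) hl (by simp)
  rw [hh] at hline
  funext w
  have hw := (hasDerivAt_pi.1 hline) w
  simp only [Pi.zero_apply, Function.comp_def] at hw
  obtain ⟨h1, h2, h3⟩ := hasDerivAt_components_of_zero hw
  by_cases hwS : w ∈ S
  · by_cases hwT : w ∈ T
    · simp only [hΦdef, if_pos hwS, if_pos hwT] at h1 h2 h3
      have := eq_zero_of_hasDerivAt_splitCentralBlock hg hcos (z₀ w) (h w) (h0T w hwT) h1 h2 h3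
      simpa using this
    · simp only [hΦdef, if_pos hwS, if_neg hwT] at h1 h2 h3
      have := eq_zero_of_hasDerivAt_splitRegularBlock hg hcosh (z₀ w) (h w) (hS w hwS hwT) h1 h2 h3
      simpa using this
  · by_cases hwP : w ∈ P
    · simp only [hΦdef, if_neg hwS, if_pos hwP] at h1 h2 h3
      have := eq_zero_of_hasDerivAt_compactCentralBlock hg hcos (z₀ w) (h w) (h0P w hwP) h1 h2 h3
      simpa using this
    · simp only [hΦdef, if_neg hwS, if_neg hwP] at h1 h2 h3
      have := eq_zero_of_hasDerivAt_compactRegularBlock hg hcos (z₀ w) (h w) (hC w hwS hwP) h1 h2 h3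
      simpa using this

omit [Fintype W] hg in
/-- **FACTORISATION `Φ ∘ sq = bzClassMap S`** at every chart point: the class map depends on the wall coordinates only through their squares (`cos ψ = g(ψ²)`,
`eˣ + e⁻ˣ = 2 g(−x²)`). [cite: Bouaziz1994IntegralesOrbitales, §4 pp. 585–586; §5.1 p. 588] -/
theorem squaredClassModel_sq_eq_bzClassMap (S P T : Finset W) (hPS : ∀ w ∈ P, w ∉ S) (hTS : T ⊆ S) (y : W → Fin 3 → ℝ) :
    (fun (z : W → Fin 3 → ℝ) (w : W) =>
      (if w ∈ S then
        ((2 * ((g (-(if w ∈ T then z w 0 else (z w 0) ^ 2)) : ℝ) : ℂ) * (Circle.exp (z w 2) : ℂ), (Circle.exp (z w 2) : ℂ) ^ 2, (Circle.exp (z w 1) : ℂ)) : ℂ × ℂ × ℂ)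
      else
        (2 * ((g (if w ∈ P then (z w 0 - z w 2) / 2 else ((z w 0 - z w 2) / 2) ^ 2) : ℝ) : ℂ) * (Circle.exp ((z w 0 + z w 2) / 2) : ℂ),
          (Circle.exp ((z w 0 + z w 2) / 2) : ℂ) ^ 2, (Circle.exp (z w 1) : ℂ))))
      (fun w => if w ∈ T then ![(y w 0) ^ 2, y w 1, y w 2]
        else if w ∈ P then ![(y w 0 + y w 2) / 2 + ((y w 0 - y w 2) / 2) ^ 2, y w 1, (y w 0 + y w 2) / 2 - ((y w 0 - y w 2) / 2) ^ 2]
        else y w) = bzClassMap S y := by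
  funext w
  by_cases hwS : w ∈ S
  · have hwP : w ∉ P := fun h => hPS w h hwS
    rw [bzClassMap_of_mem hwS]
    by_cases hwT : w ∈ T
    · simp only [if_pos hwS, if_pos hwT, Matrix.cons_val_zero, Matrix.cons_val_one, Matrix.cons_val_two, Matrix.head_cons, Matrix.tail_cons]
      rw [exp_add_exp_neg_eq hcosh]
      push_cast; ring_nf
    · simp only [if_pos hwS, if_neg hwT, if_neg hwP]
      rw [exp_add_exp_neg_eq hcosh]
      push_cast; ring_nf
  · have hwT : w ∉ T := fun h => hwS (hTS h)
    rw [bzClassMap_of_not_mem hwS]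
    by_cases hwP : w ∈ P
    · simp only [if_neg hwS, if_neg hwT, if_pos hwP, Matrix.cons_val_zero, Matrix.cons_val_one, Matrix.cons_val_two, Matrix.head_cons, Matrix.tail_cons]
      rw [coe_circleExp_add_coe_circleExp (y w 0) (y w 2), coe_circleExp_mul_coe_circleExp (y w 0) (y w 2), hcos]
      congr 2 <;> ring_nf
    · simp only [if_neg hwS, if_neg hwT, if_neg hwP]
      rw [coe_circleExp_add_coe_circleExp (y w 0) (y w 2), coe_circleExp_mul_coe_circleExp (y w 0) (y w 2), hcos]

end Model

/-! ## §6 The invariant product bump and the reflections of the wall coordinates -/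

section Bump

variable {W : Type*} [Fintype W] [DecidableEq W]

/-- **An invariant smooth product bump at a wall point**: for `δ > 0` there is a smooth `χ : (W → Fin 3 → ℝ) → ℝ`, `= 1` on `ball c₀ (δ/2)`, vanishing off `closedBall c₀ (3δ/4)`
(hence `tsupport χ ⊆ ball c₀ δ`), invariant under `flipAt w` whenever `c₀ w 0 = c₀ w 2` and under `negXAt w` whenever `c₀ w 0 = 0` (a product of EVEN one-variable bumps in the
coordinates `y w i − c₀ w i`). [cite: HormanderALPDO1, Thm. 1.4.1] -/
theorem exists_invariant_bump (c₀ : W → Fin 3 → ℝ) {δ : ℝ} (hδ : 0 < δ) :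
    ∃ χ : (W → Fin 3 → ℝ) → ℝ, ContDiff ℝ ∞ χ ∧ (∀ y ∈ Metric.ball c₀ (δ / 2), χ y = 1) ∧ (∀ y, y ∉ Metric.ball c₀ δ → χ =ᶠ[𝓝 y] 0) ∧
      (∀ y, χ y ≠ 0 → y ∈ Metric.ball c₀ δ) ∧
      (∀ w, c₀ w 0 = c₀ w 2 → ∀ y, χ (flipAt w y) = χ y) ∧ (∀ w, c₀ w 0 = 0 → ∀ y, χ (negXAt w y) = χ y) := by
  let β : ContDiffBump (0 : ℝ) := ⟨δ / 2, 3 * δ / 4, by linarith, by linarith⟩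
  -- an even one-variable bump
  set b : ℝ → ℝ := fun t => β t * β (-t) with hb
  have hbs : ContDiff ℝ ∞ b := β.contDiff.mul (β.contDiff.comp contDiff_neg)
  have hbeven : ∀ t, b (-t) = b t := fun t => by simp only [hb, neg_neg]; ring
  have hb1 : ∀ t, |t| ≤ δ / 2 → b t = 1 := fun t ht => by
    have h1 : β t = 1 := β.one_of_mem_closedBall (by simpa using ht)
    have h2 : β (-t) = 1 := β.one_of_mem_closedBall (by simpa using ht)
    simp only [hb, h1, h2, mul_one]
  have hb0 : ∀ t, b t ≠ 0 → |t| < 3 * δ / 4 := fun t ht => by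
    have h1 : β t ≠ 0 := fun h => ht (by simp only [hb, h, zero_mul])
    have : t ∈ Function.support (β : ℝ → ℝ) := h1
    rw [β.support_eq] at this
    simpa using this
  set χ : (W → Fin 3 → ℝ) → ℝ := fun y => ∏ w, ∏ i, b (y w i - c₀ w i) with hχ
  have hχs : ContDiff ℝ ∞ χ := by
    refine contDiff_prod fun w _ => contDiff_prod fun i _ => hbs.comp ?_
    exact (contDiff_apply_apply ℝ ℝ w i).sub contDiff_const
  have hχball : ∀ y, χ y ≠ 0 → y ∈ Metric.ball c₀ δ := fun y hy => by
    rw [Metric.mem_ball, dist_eq_norm]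
    have h34 : ‖y - c₀‖ < 3 * δ / 4 := by
      rw [pi_norm_lt_iff (by linarith)]
      intro w
      rw [pi_norm_lt_iff (by linarith)]
      intro i
      rw [Real.norm_eq_abs]
      refine hb0 _ fun h0 => hy ?_
      exact Finset.prod_eq_zero (Finset.mem_univ w) (Finset.prod_eq_zero (Finset.mem_univ i) (by simpa using h0))
    linarith
  refine ⟨χ, hχs, fun y hy => ?_, fun y hy => ?_, hχball, fun w hw y => ?_, fun w hw y => ?_⟩
  · -- `= 1` on the half ball
    rw [Metric.mem_ball, dist_eq_norm] at hy
    refine Finset.prod_eq_one fun w _ => Finset.prod_eq_one fun i _ => hb1 _ ?_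
    calc |y w i - c₀ w i| = ‖(y - c₀) w i‖ := by simp [Real.norm_eq_abs]
      _ ≤ ‖(y - c₀) w‖ := norm_le_pi_norm _ i
      _ ≤ ‖y - c₀‖ := norm_le_pi_norm _ w
      _ ≤ δ / 2 := hy.le
  · -- off the ball `χ` vanishes identically near `y`
    have hcl : IsClosed {y : W → Fin 3 → ℝ | 3 * δ / 4 ≤ ‖y - c₀‖} := isClosed_le continuous_const (continuous_id.sub continuous_const).norm
    have hopen : IsOpen {y : W → Fin 3 → ℝ | 3 * δ / 4 < ‖y - c₀‖} := isOpen_lt continuous_const (continuous_id.sub continuous_const).norm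
    have hy' : 3 * δ / 4 < ‖y - c₀‖ := by
      rw [Metric.mem_ball, dist_eq_norm, not_lt] at hy
      linarith
    filter_upwards [hopen.mem_nhds hy'] with z hz
    by_contra hne
    have := hχball z hne
    rw [Metric.mem_ball, dist_eq_norm] at this
    have hz' : 3 * δ / 4 < ‖z - c₀‖ := hz
    -- from `χ z ≠ 0` every coordinate is `< 3δ/4`
    have h34 : ‖z - c₀‖ < 3 * δ / 4 := by
      rw [pi_norm_lt_iff (by linarith)]
      intro w
      rw [pi_norm_lt_iff (by linarith)]
      intro i
      rw [Real.norm_eq_abs]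
      refine hb0 _ fun h0 => hne ?_
      exact Finset.prod_eq_zero (Finset.mem_univ w) (Finset.prod_eq_zero (Finset.mem_univ i) (by simpa using h0))
    linarith
  · -- invariance under `flipAt w` when `c₀ w 0 = c₀ w 2`
    simp only [hχ]
    refine Finset.prod_congr rfl fun w' _ => ?_
    by_cases hww : w' = w
    · subst hww
      simp only [flipAt, Function.update_self, Fin.prod_univ_three, Matrix.cons_val_zero, Matrix.cons_val_one, Matrix.cons_val_two,
        Matrix.head_cons, Matrix.tail_cons, hw]
      ring
    · rw [flipAt_apply_of_ne hww]
  · -- invariance under `negXAt w` when `c₀ w 0 = 0`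
    simp only [hχ]
    refine Finset.prod_congr rfl fun w' _ => ?_
    by_cases hww : w' = w
    · subst hww
      simp only [negXAt, Function.update_self, Fin.prod_univ_three, Matrix.cons_val_zero, Matrix.cons_val_one, Matrix.cons_val_two,
        Matrix.head_cons, Matrix.tail_cons, hw, sub_zero]
      rw [hbeven]
    · rw [negXAt_apply_of_ne hww]

end Bump

/-! ## §7 The wall reflections as `y ↦ y − 2ℓ_w(y) • v_w` and the squared-coordinate map -/

section Reflections

variable {W : Type*} [DecidableEq W]

/-- `flipAt w` is the reflection `y ↦ y − 2ψ_w(y) • nrm w`, `ψ_w(y) = (y w 0 − y w 2)/2`. [cite: Bouaziz1994IntegralesOrbitales, §4 pp. 585–586] -/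
theorem flipAt_eq_sub_smul_nrm (w : W) (y : W → Fin 3 → ℝ) : flipAt w y = y - (2 * ((y w 0 - y w 2) / 2)) • nrm w := by
  funext w' i
  by_cases hww : w' = w
  · subst hww
    simp only [flipAt, nrm, Function.update_self, Pi.sub_apply, Pi.smul_apply, Pi.single_eq_same, smul_eq_mul]
    fin_cases i
    · simp; ring
    · simp
    · simp; ring
  · rw [flipAt_apply_of_ne hww]
    simp [nrm, hww]

/-- `negXAt w` is the reflection `y ↦ y − 2x_w(y) • e_{(w,0)}`. [cite: Bouaziz1994IntegralesOrbitales, §4 pp. 585–586] -/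
theorem negXAt_eq_sub_smul_single (w : W) (y : W → Fin 3 → ℝ) :
    negXAt w y = y - (2 * y w 0) • (Pi.single w ![(1 : ℝ), 0, 0] : W → Fin 3 → ℝ) := by
  funext w' i
  by_cases hww : w' = w
  · subst hww
    simp only [negXAt, Function.update_self, Pi.sub_apply, Pi.smul_apply, Pi.single_eq_same, smul_eq_mul]
    fin_cases i
    · simp; ring
    · simp
    · simp
  · rw [negXAt_apply_of_ne hww]
    simp [hww]

/-- Evaluation of the squared-coordinate map `y ↦ y + ∑_{w ∈ P ∪ T} (ℓ_w(y)² − ℓ_w(y)) • v_w` (`ℓ`, `v` as in (W2c)): split coordinates of `T` squared, wall coordinates of `P`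
replaced by `σ ± ψ²`, every other place untouched. [cite: Bouaziz1994IntegralesOrbitales, §4 pp. 585–586] -/
theorem sq_apply (S P T : Finset W) (hPS : ∀ w ∈ P, w ∉ S) (hTS : T ⊆ S) (y : W → Fin 3 → ℝ) (w : W) :
    (y + ∑ i ∈ P ∪ T, (((if i ∈ S then y i 0 else (y i 0 - y i 2) / 2) ^ 2 - (if i ∈ S then y i 0 else (y i 0 - y i 2) / 2)) •
      (if i ∈ S then (Pi.single i ![(1 : ℝ), 0, 0] : W → Fin 3 → ℝ) else nrm i))) w =
    (if w ∈ T then ![(y w 0) ^ 2, y w 1, y w 2]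
      else if w ∈ P then ![(y w 0 + y w 2) / 2 + ((y w 0 - y w 2) / 2) ^ 2, y w 1, (y w 0 + y w 2) / 2 - ((y w 0 - y w 2) / 2) ^ 2]
      else y w) := by
  have hv : ∀ i w', w' ≠ i → (if i ∈ S then (Pi.single i ![(1 : ℝ), 0, 0] : W → Fin 3 → ℝ) else nrm i) w' = 0 := by
    intro i w' hne
    split_ifs
    · simp [hne]
    · simp [nrm, hne]
  rw [Pi.add_apply, Finset.sum_apply]
  by_cases hPT : w ∈ P ∪ T
  · rw [Finset.sum_eq_single w (fun i _ hne => by rw [Pi.smul_apply, hv i w hne.symm, smul_zero]) (fun h => absurd hPT h)]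
    rcases Finset.mem_union.1 hPT with hP | hT
    · have hwS : w ∉ S := hPS w hP
      have hwT : w ∉ T := fun h => hwS (hTS h)
      simp only [if_neg hwS, if_neg hwT, if_pos hP, Pi.smul_apply, nrm, Pi.single_eq_same]
      funext i
      fin_cases i
      · simp; ring
      · simp
      · simp; ring
    · have hwS : w ∈ S := hTS hT
      simp only [if_pos hwS, if_pos hT, Pi.smul_apply, Pi.single_eq_same]
      funext i
      fin_cases i
      · simp
      · simp
      · simp
  · rw [Finset.sum_eq_zero (fun i hi => by rw [Pi.smul_apply, hv i w (fun h => hPT (h ▸ hi)), smul_zero])]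
    have hP : w ∉ P := fun h => hPT (Finset.mem_union_left _ h)
    have hT : w ∉ T := fun h => hPT (Finset.mem_union_right _ h)
    simp only [if_neg hP, if_neg hT, add_zero]

end Reflections


/-! ## §8 (W2c) THE HEAD: invariant smooth germs are class functions times the compact sine factor, radius before germ -/

section Main

variable {W : Type} [Fintype W] [DecidableEq W]   -- universe 0: (W2a)'s one-universe `{V E : Type u}` with `E := ℂ` forces it; the payer's `W = {w // IsComplex w} : Type`

/-- **(W2c) INVARIANT SMOOTH GERM = CLASS FUNCTION** — the `hW2` organ of ★ `wallGerm_classMultiple_of_parts` (LH3-p01 (g6) ★ p851576), TOKEN FOR TOKEN.  At a fibre point `c₀` of the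
chart `S` (ON the compact walls of `P`, ON the split walls of `T ⊆ S`, regular at every other place) and for every radius `δ > 0` there is `δ′ > 0`, FIXED BEFORE THE GERM, such that
every `G` smooth on `ball c₀ δ`, odd under the compact-wall flips `flipAt w` (`w ∈ P`) and even under the split-wall sign changes `negXAt w` (`w ∈ T`), reads on `ball c₀ δ′` as
`(∏_{w ∉ S} 2i sin((c w 0 − c w 2)/2)) · U(bzClassMap S c)` with `U` a GLOBAL smooth function on the class space.  Road: invariant product bump (§6) ⇒ global parities ⇒ the
parity normal form ★ `exists_contDiff_parity_normalForm` ((W2a), A-p12 (g28)) `G = (∏_P ψ_w) · H ∘ sq`; `sin ψ = −2ψ g′(ψ²)` (§1) converts `∏_P ψ_w` into the sine factor up to the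
smooth unit `D̃ ∘ sq` (non-zero at `sq c₀`: `g′(0) = −1/2`, `sin ψ_w(c₀) ≠ 0` at the compact regular places), whose reciprocal is globalised once (★ `exists_contDiff_eventuallyEq_of_contDiffOn`);
the squared-coordinate model `Φ` (§5: smooth, `Φ ∘ sq = bzClassMap S`, injective differential at `sq c₀`) pushes `H · R` forward to the class space by ★
`exists_nhds_forall_contDiff_comp_eq_of_injective_fderiv` ((W2b)) on a neighbourhood fixed by `Φ` alone — whence `δ′` before `G`.
[cite: Bouaziz1994IntegralesOrbitales, §3.2 p. 580; §4 pp. 585–586; §5.1 p. 588] [cite: Shelstad1979, §4 Lemma 4.3 (p. 25)] -/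
theorem exists_contDiff_classFunction_of_parity (S P T : Finset W) {c₀ : W → Fin 3 → ℝ} (hPS : ∀ w ∈ P, w ∉ S) (hTS : T ⊆ S)
    (hP : ∀ w ∈ P, c₀ w 0 = c₀ w 2) (hT : ∀ w ∈ T, c₀ w 0 = 0)
    (hSreg : ∀ w ∈ S, w ∉ T → c₀ w 0 ≠ 0) (hCreg : ∀ w, w ∉ S → w ∉ P → Circle.exp (c₀ w 0) ≠ Circle.exp (c₀ w 2))
    {δ : ℝ} (hδ : 0 < δ) :
    ∃ δ' : ℝ, 0 < δ' ∧ ∀ G : (W → Fin 3 → ℝ) → ℂ, ContDiffOn ℝ ∞ G (Metric.ball c₀ δ) →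
      (∀ w ∈ P, ∀ c ∈ Metric.ball c₀ δ, G (flipAt w c) = -G c) → (∀ w ∈ T, ∀ c ∈ Metric.ball c₀ δ, G (negXAt w c) = G c) →
      ∃ U : (W → ℂ × ℂ × ℂ) → ℂ, ContDiff ℝ ∞ U ∧
        ∀ c ∈ Metric.ball c₀ δ', G c = (∏ w ∈ Finset.univ \ S, (2 * I * (Real.sin ((c w 0 - c w 2) / 2) : ℂ))) * U (bzClassMap S c) := by
  obtain ⟨g, hg, hcos, hcosh⟩ := Literature.Analysis.Calculus.exists_contDiff_cos_eq_comp_sq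
  have hgd : Differentiable ℝ g := hg.differentiable (by simp)
  -- the reflection data of the wall coordinates
  set ev : W → (W → Fin 3 → ℝ) →L[ℝ] (Fin 3 → ℝ) := fun w => ContinuousLinearMap.proj (R := ℝ) (φ := fun _ : W => Fin 3 → ℝ) w with hevdef
  set pr : Fin 3 → (Fin 3 → ℝ) →L[ℝ] ℝ := fun i => ContinuousLinearMap.proj (R := ℝ) (φ := fun _ : Fin 3 => ℝ) i with hprdef
  set ℓ : W → (W → Fin 3 → ℝ) →L[ℝ] ℝ := fun w => if w ∈ S then (pr 0).comp (ev w)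
      else (1 / 2 : ℝ) • ((pr 0).comp (ev w) - (pr 2).comp (ev w)) with hℓdef
  have hℓ : ∀ w (y : W → Fin 3 → ℝ), ℓ w y = if w ∈ S then y w 0 else (y w 0 - y w 2) / 2 := by
    intro w y
    by_cases hw : w ∈ S
    · simp [hℓdef, hevdef, hprdef, hw]
    · simp [hℓdef, hevdef, hprdef, hw]; ring
  set v : W → (W → Fin 3 → ℝ) := fun w => if w ∈ S then (Pi.single w ![(1 : ℝ), 0, 0] : W → Fin 3 → ℝ) else nrm w with hvdef
  set sq : (W → Fin 3 → ℝ) → (W → Fin 3 → ℝ) := fun y => y + ∑ i ∈ P ∪ T, ((ℓ i y) ^ 2 - ℓ i y) • v i with hsqdef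
  have hsq : ∀ y w, sq y w = (if w ∈ T then ![(y w 0) ^ 2, y w 1, y w 2]
      else if w ∈ P then ![(y w 0 + y w 2) / 2 + ((y w 0 - y w 2) / 2) ^ 2, y w 1, (y w 0 + y w 2) / 2 - ((y w 0 - y w 2) / 2) ^ 2] else y w) := by
    intro y w
    simp only [hsqdef, hvdef, hℓ]
    exact sq_apply S P T hPS hTS y w
  have hsqfun : ∀ y, sq y = fun w => (if w ∈ T then ![(y w 0) ^ 2, y w 1, y w 2]
      else if w ∈ P then ![(y w 0 + y w 2) / 2 + ((y w 0 - y w 2) / 2) ^ 2, y w 1, (y w 0 + y w 2) / 2 - ((y w 0 - y w 2) / 2) ^ 2] else y w) :=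
    fun y => funext (hsq y)
  -- evaluations of `sq` used below
  have hsqT : ∀ y, ∀ w ∈ T, sq y w 0 = (y w 0) ^ 2 := fun y w hw => by rw [hsq, if_pos hw]; simp
  have hsqP0 : ∀ y, ∀ w ∈ P, (sq y w 0 - sq y w 2) / 2 = ((y w 0 - y w 2) / 2) ^ 2 := fun y w hw => by
    have hwT : w ∉ T := fun h => hPS w hw (hTS h)
    rw [hsq, if_neg hwT, if_pos hw]; simp
  have hsqO : ∀ y w, w ∉ T → w ∉ P → sq y w = y w := fun y w hwT hwP => by rw [hsq, if_neg hwT, if_neg hwP]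
  -- the squared-coordinate model of the class map
  set Φ := (fun (z : W → Fin 3 → ℝ) (w : W) =>
      (if w ∈ S then
        ((2 * ((g (-(if w ∈ T then z w 0 else (z w 0) ^ 2)) : ℝ) : ℂ) * (Circle.exp (z w 2) : ℂ), (Circle.exp (z w 2) : ℂ) ^ 2, (Circle.exp (z w 1) : ℂ)) : ℂ × ℂ × ℂ)
      else
        (2 * ((g (if w ∈ P then (z w 0 - z w 2) / 2 else ((z w 0 - z w 2) / 2) ^ 2) : ℝ) : ℂ) * (Circle.exp ((z w 0 + z w 2) / 2) : ℂ),
          (Circle.exp ((z w 0 + z w 2) / 2) : ℂ) ^ 2, (Circle.exp (z w 1) : ℂ)))) with hΦdef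
  have hΦs : ContDiff ℝ ∞ Φ := contDiff_squaredClassModel hg S P T
  have hΦsq : ∀ y, Φ (sq y) = bzClassMap S y := fun y => by
    rw [hsqfun y]
    exact squaredClassModel_sq_eq_bzClassMap (g := g) hcos hcosh S P T hPS hTS y
  have hinj : Function.Injective (fderiv ℝ Φ (sq c₀)) := by
    refine injective_fderiv_squaredClassModel hg hcos hcosh S P T ?_ ?_ ?_ ?_
    · intro w hw; simp [hsqT c₀ w hw, hT w hw]
    · intro w hw
      have h := hsqP0 c₀ w hw
      rw [hP w hw, sub_self, zero_div] at h
      have : sq c₀ w 0 - sq c₀ w 2 = 0 := by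
        have := h; simp at this; linarith
      linarith
    · intro w hwS hwT
      rw [hsqO c₀ w hwT (fun h => hPS w h hwS)]; exact hSreg w hwS hwT
    · intro w hwS hwP
      rw [hsqO c₀ w (fun h => hwS (hTS h)) hwP]; exact hCreg w hwS hwP
  -- the smooth unit `D̃` with `∏_{w ∉ S} 2 I sin ψ_w = (∏_{w ∈ P} ψ_w) · D̃ ∘ sq`
  set Dt : (W → Fin 3 → ℝ) → ℂ := fun z => (∏ w ∈ P, (-4 * I * ((deriv g (ℓ w z) : ℝ) : ℂ))) *
      ∏ w ∈ (Finset.univ \ S) \ P, (2 * I * (Real.sin ((z w 0 - z w 2) / 2) : ℂ)) with hDtdef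
  have hDts : ContDiff ℝ ∞ Dt := by
    refine (contDiff_prod fun w _ => contDiff_const.mul (Complex.ofRealCLM.contDiff.comp ((hg.deriv').comp (ℓ w).contDiff))).mul
      (contDiff_prod fun w _ => contDiff_const.mul (Complex.ofRealCLM.contDiff.comp (Real.contDiff_sin.comp ?_)))
    exact (((contDiff_apply_apply ℝ ℝ w 0).sub (contDiff_apply_apply ℝ ℝ w 2)).div_const 2)
  have hPsub : P ⊆ Finset.univ \ S := fun w hw => Finset.mem_sdiff.2 ⟨Finset.mem_univ _, hPS w hw⟩
  have hprod : ∀ y : W → Fin 3 → ℝ, (∏ w ∈ Finset.univ \ S, (2 * I * (Real.sin ((y w 0 - y w 2) / 2) : ℂ))) =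
      (∏ w ∈ P, ((ℓ w y : ℝ) : ℂ)) * Dt (sq y) := by
    intro y
    rw [← Finset.prod_sdiff hPsub, hDtdef]
    simp only []
    have h1 : ∏ w ∈ P, (2 * I * (Real.sin ((y w 0 - y w 2) / 2) : ℂ)) = (∏ w ∈ P, ((ℓ w y : ℝ) : ℂ)) * ∏ w ∈ P, (-4 * I * ((deriv g (ℓ w (sq y)) : ℝ) : ℂ)) := by
      rw [← Finset.prod_mul_distrib]
      refine Finset.prod_congr rfl fun w hw => ?_
      have hwS : w ∉ S := hPS w hw
      rw [sin_eq_neg_two_mul_mul_deriv hg hcos, hℓ, if_neg hwS, hℓ, if_neg hwS, hsqP0 y w hw]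
      push_cast; ring
    have h2 : ∏ w ∈ (Finset.univ \ S) \ P, (2 * I * (Real.sin ((y w 0 - y w 2) / 2) : ℂ)) =
        ∏ w ∈ (Finset.univ \ S) \ P, (2 * I * (Real.sin ((sq y w 0 - sq y w 2) / 2) : ℂ)) := by
      refine Finset.prod_congr rfl fun w hw => ?_
      obtain ⟨hw1, hwP⟩ := Finset.mem_sdiff.1 hw
      have hwS : w ∉ S := (Finset.mem_sdiff.1 hw1).2
      rw [hsqO y w (fun h => hwS (hTS h)) hwP]
    rw [h1, h2]; ring
  have hDt0 : Dt (sq c₀) ≠ 0 := by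
    rw [hDtdef]
    refine mul_ne_zero (Finset.prod_ne_zero_iff.2 fun w hw => ?_) (Finset.prod_ne_zero_iff.2 fun w hw => ?_)
    · have hwS : w ∉ S := hPS w hw
      have h0 : ℓ w (sq c₀) = 0 := by
        rw [hℓ, if_neg hwS, hsqP0 c₀ w hw, hP w hw]; simp
      rw [h0, deriv_profile_zero hg hcos]
      norm_num [Complex.I_ne_zero]
    · obtain ⟨hw1, hwP⟩ := Finset.mem_sdiff.1 hw
      have hwS : w ∉ S := (Finset.mem_sdiff.1 hw1).2
      rw [hsqO c₀ w (fun h => hwS (hTS h)) hwP]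
      have hsin : Real.sin ((c₀ w 0 - c₀ w 2) / 2) ≠ 0 := by
        intro h0
        obtain ⟨n, hn⟩ := Real.sin_eq_zero_iff.1 h0
        exact (circleExp_ne_iff_forall_int (c₀ w 0) (c₀ w 2)).1 (hCreg w hwS hwP) n (by linarith)
      exact mul_ne_zero (mul_ne_zero two_ne_zero Complex.I_ne_zero) (Complex.ofReal_ne_zero.2 hsin)
  -- the reciprocal of the unit, globalised once (function-free)
  have hUopen : IsOpen {z : W → Fin 3 → ℝ | Dt z ≠ 0} := isOpen_ne_fun hDts.continuous continuous_const
  obtain ⟨R, hRs, hR⟩ := exists_contDiff_eventuallyEq_of_contDiffOn' hUopen hDt0 (hDts.contDiffOn.inv fun z hz => hz)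
  -- the push-forward neighbourhood of the immersion (function-free)
  obtain ⟨N, hN, hpush⟩ := exists_nhds_forall_contDiff_comp_eq_of_injective_fderiv' (E := ℂ) (n := (⊤ : ℕ∞)) le_top
    isOpen_univ (Set.mem_univ (sq c₀)) hΦs.contDiffOn hinj
  -- the radius `δ′`
  have hsqc : Continuous sq := by
    simp only [hsqdef]
    fun_prop
  have hA : {y : W → Fin 3 → ℝ | sq y ∈ N ∧ R (sq y) = (Dt (sq y))⁻¹ ∧ Dt (sq y) ≠ 0} ∈ 𝓝 c₀ := by
    refine Filter.inter_mem (hsqc.continuousAt.preimage_mem_nhds hN) (Filter.inter_mem ?_ ?_)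
    · exact hsqc.continuousAt.preimage_mem_nhds hR
    · exact hsqc.continuousAt.preimage_mem_nhds (hUopen.mem_nhds hDt0)
  obtain ⟨δ₁, hδ₁, hball⟩ := Metric.mem_nhds_iff.1 hA
  refine ⟨min δ₁ (δ / 2), lt_min hδ₁ (half_pos hδ), fun G hG hodd heven => ?_⟩
  -- globalise `G` with the invariant bump
  obtain ⟨χ, hχs, hχ1, hχ0, hχball, hχflip, hχneg⟩ := exists_invariant_bump c₀ hδ
  set G₀ : (W → Fin 3 → ℝ) → ℂ := fun y => (χ y : ℂ) * G y with hG₀def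
  have hG₀s : ContDiff ℝ ∞ G₀ := by
    rw [contDiff_iff_contDiffAt]
    intro y
    by_cases hy : y ∈ Metric.ball c₀ δ
    · exact (Complex.ofRealCLM.contDiff.comp hχs).contDiffAt.mul (hG.contDiffAt (Metric.isOpen_ball.mem_nhds hy))
    · have h0 : G₀ =ᶠ[𝓝 y] fun _ => 0 := by
        filter_upwards [hχ0 y hy] with z hz
        simp only [hG₀def, hz, Pi.zero_apply, Complex.ofReal_zero, zero_mul]
      exact (contDiffAt_const (c := (0 : ℂ))).congr_of_eventuallyEq h0
  have hχout : ∀ y, y ∉ Metric.ball c₀ δ → χ y = 0 := fun y hy => by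
    by_contra h; exact hy (hχball y h)
  have hG₀odd : ∀ w ∈ P, ∀ y, G₀ (y - (2 * ℓ w y) • v w) = -G₀ y := by
    intro w hw y
    have hwS : w ∉ S := hPS w hw
    have hrefl : y - (2 * ℓ w y) • v w = flipAt w y := by
      rw [hℓ, if_neg hwS, show v w = nrm w by simp [hvdef, hwS], flipAt_eq_sub_smul_nrm]
    rw [hrefl]
    show (χ (flipAt w y) : ℂ) * G (flipAt w y) = -((χ y : ℂ) * G y)
    rw [hχflip w (hP w hw)]
    by_cases hy : y ∈ Metric.ball c₀ δ
    · rw [hodd w hw y hy]; ring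
    · rw [hχout y hy]; simp
  have hG₀even : ∀ w ∈ T, ∀ y, G₀ (y - (2 * ℓ w y) • v w) = G₀ y := by
    intro w hw y
    have hwS : w ∈ S := hTS hw
    have hrefl : y - (2 * ℓ w y) • v w = negXAt w y := by
      rw [hℓ, if_pos hwS, show v w = (Pi.single w ![(1 : ℝ), 0, 0] : W → Fin 3 → ℝ) by simp [hvdef, hwS], negXAt_eq_sub_smul_single]
    rw [hrefl]
    show (χ (negXAt w y) : ℂ) * G (negXAt w y) = (χ y : ℂ) * G y
    rw [hχneg w (hT w hw)]
    by_cases hy : y ∈ Metric.ball c₀ δ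
    · rw [heven w hw y hy]
    · rw [hχout y hy]; simp
  have hbi : ∀ i ∈ P ∪ T, ∀ j ∈ P ∪ T, ℓ i (v j) = if i = j then 1 else 0 := by
    intro i _ j _
    rw [hℓ]
    by_cases hij : i = j
    · subst hij
      by_cases hiS : i ∈ S
      · simp [hvdef, hiS]
      · simp [hvdef, hiS, nrm]
    · have hv0 : v j i = 0 := by
        by_cases hjS : j ∈ S
        · simp [hvdef, hjS, hij]
        · simp [hvdef, hjS, nrm, hij]
      rw [if_neg hij]
      split_ifs <;> simp [hv0]
  have hdisj : Disjoint P T := Finset.disjoint_left.2 fun w hwP hwT => hPS w hwP (hTS hwT)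
  -- (W2a): the parity normal form
  obtain ⟨H, hHs, hHeq⟩ := Literature.Analysis.Calculus.exists_contDiff_parity_normalForm P T hdisj ℓ v hbi hG₀s hG₀odd hG₀even
  -- push `H · R` forward along `Φ`
  obtain ⟨U, hUs, hU⟩ := hpush (fun z => H z * R z) (hHs.mul hRs)
  refine ⟨U, hUs, fun c hc => ?_⟩
  have hc₁ : c ∈ Metric.ball c₀ δ₁ := Metric.ball_subset_ball (min_le_left _ _) hc
  have hc₂ : c ∈ Metric.ball c₀ (δ / 2) := Metric.ball_subset_ball (min_le_right _ _) hc
  obtain ⟨hcN, hcR, hcD⟩ := hball hc₁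
  have hGc : G c = G₀ c := by
    show G c = (χ c : ℂ) * G c
    rw [hχ1 c hc₂]; simp
  have hHeq' : G₀ c = (∏ i ∈ P, ℓ i c) • H (sq c) := hHeq c
  set Hs : ℂ := H (sq c) with hHsdef
  set Dc : ℂ := Dt (sq c) with hDcdef
  have hcanc : Dc * (Hs * Dc⁻¹) = Hs := by field_simp
  rw [hGc, hHeq', hprod c, ← hΦsq c, hU (sq c) hcN, Complex.real_smul, Complex.ofReal_prod, hcR, mul_assoc, hcanc]

end Main

end Literature.NumberTheory.Rogawski1990

end
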